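import Summits.CriticalPhenomena.PercolationContinuityZ3.Theorems.PercLowPointHalfSpaceQuantitativeBGNFloorDefs
import Summits.CriticalPhenomena.PercolationContinuityZ3.Theorems.PercLowPointHalfSpaceQuantitativeBGNFloorArmLocality
import Literature.Probability.Percolation.HalfSpaceFloorDilution
import Literature.Probability.Percolation.ProdBernoulliRusso
import Literature.Probability.Percolation.LongRangeKernelPercolationProofs
import HarnessLib

/-!
# `QuantitativeBGN` (stmt-CriticalPhenomena-0913), line `microscopic-floor-doubling-gain` — STUB 3a `stub_floorDeriv`

Crux `Summit.CriticalPhenomena.PercolationContinuityZ3.Theses.PercLowPointHalfSpace.QuantitativeBGN`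
(item stmt-CriticalPhenomena-0913), line `microscopic-floor-doubling-gain`, stub `stub_floorDeriv`
(the percolation half of the one-sided integrated Russo inequality in the floor density; the
calculus half is `stub_russoCalc`, and the two are glued by the skeleton's `floorRusso_of`).

With `f_j(s) = armProbFloor r j s = P^{ℍ}_{p_c,s}(armFrom r j)` and
`g_j(s) = pivotalFloorSum r j s = Σ_{e ∈ floorEdgesIn (r+j+1)} P^{ℍ}_{p_c,s}(e pivotal for armFrom r j)`
(`Theorems/PercLowPointHalfSpaceQuantitativeBGNFloorDefs.lean`), the statement proved is, for all
`r j`: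

1. `f_j(1) = γ_r(j)` (`FloorDoubling.armProbFloor_one`, landed with the arm-locality API);
2. `t ↦ f_j(projIcc t)` is continuous on `ℝ`;
3. `t ↦ g_j(projIcc t)` is continuous on `ℝ`;
4. `HasDerivAt (t ↦ f_j(projIcc t)) (p_c · g_j(projIcc b)) b` for every `b ∈ (0,1)`.

Proof. The floor-diluted measure is the product Bernoulli measure `prodBernoulli` with weights
`floorDilutedParam 3 p_c s` (`s · p_c` on floor edges, `p_c` on the other half-space edges, `0`
elsewhere), so along the path `t ↦ floorDilutedParam 3 p_c (projIcc t)` every coordinate weight is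
continuous in `t` (`FloorDeriv.continuous_coe_param`) and, for `b ∈ (0,1)` where the clamp
`projIcc` is the identity, differentiable at `b` with derivative `p_c` on floor edges and `0`
elsewhere (`FloorDeriv.hasDerivAt_coe_param`). The arm event `armFrom r j` is increasing and
determined by the finite set `K = (box 3 (r+j)).sym2` (`isUpperSet_armFrom`, `determinedBy_armFrom`),
and each pivotality event `{e pivotal}` is determined by `K \ {e}` (`Russo.determinedBy_isPivotal`).
Hence (2) and (3) follow from the continuity of cylinder polynomials
(`continuous_prodBernoulli_real_of_determinedBy`), and (4) from the multi-parameter Russo formula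
`hasDerivAt_prodBernoulli_real`, whose derivative `Σ_{e ∈ K} p'_e · P(e pivotal)` equals
`p_c · g_j`: the terms with `e ∉ floorEdgeSet 3` carry `p'_e = 0`, the floor edges of `K` lie in
`floorEdgesIn (r+j+1)`, and the remaining edges of `floorEdgesIn (r+j+1)` are never pivotal
(`Russo.mem_of_isPivotal`: a pivotal coordinate lies in the determining set `K`)
(`FloorDeriv.sum_ite_mul_real_pivotal_eq`).
-/

noncomputable section

namespace Summit.CriticalPhenomena.PercolationContinuityZ3.Theorems

open MeasureTheory Literature.Probability.Percolation Literature.Probability.LatticeModels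
open FloorDoubling
open scoped Classical

namespace FloorDeriv

/-! ### The parameter path `t ↦ floorDilutedParam 3 p_c (projIcc t)` coordinatewise -/

/-- Every coordinate weight `t ↦ (floorDilutedParam 3 p_c (projIcc t)) e` is continuous in `t`:
it is `t ↦ projIcc t · p_c` on a floor edge and constant (`p_c` or `0`) otherwise. [folklore] -/
theorem continuous_coe_param (e : Sym2 (Site 3)) :
    Continuous fun t : ℝ =>
      (floorDilutedParam 3 (criticalProbI 3) (Set.projIcc (0 : ℝ) 1 zero_le_one t) e : ℝ) := by
  by_cases hf : e ∈ floorEdgeSet 3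
  · simp only [floorDilutedParam_of_mem_floorEdgeSet (criticalProbI 3) _ hf, Set.Icc.coe_mul]
    exact (continuous_subtype_val.comp continuous_projIcc).mul continuous_const
  · by_cases he : e ∈ halfSpaceEdgeSet 3
    · simp only [floorDilutedParam_of_not_mem_floorEdgeSet (criticalProbI 3) _ he hf]
      exact continuous_const
    · simp only [floorDilutedParam_of_not_mem_halfSpaceEdgeSet (criticalProbI 3) _ he]
      exact continuous_const

/-- On `(0,1)` the clamp `projIcc` is the identity, so at `b ∈ (0,1)` the coordinate weight
`t ↦ (floorDilutedParam 3 p_c (projIcc t)) e` has derivative `p_c` if `e` is a floor edge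
(`t · p_c` near `b`) and `0` otherwise (a constant). [folklore] -/
theorem hasDerivAt_coe_param (e : Sym2 (Site 3)) {b : ℝ} (hb : b ∈ Set.Ioo (0 : ℝ) 1) :
    HasDerivAt (fun t : ℝ =>
        (floorDilutedParam 3 (criticalProbI 3) (Set.projIcc (0 : ℝ) 1 zero_le_one t) e : ℝ))
      (if e ∈ floorEdgeSet 3 then (criticalProbI 3 : ℝ) else 0) b := by
  by_cases hf : e ∈ floorEdgeSet 3
  · simp only [floorDilutedParam_of_mem_floorEdgeSet (criticalProbI 3) _ hf, Set.Icc.coe_mul, hf,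
      if_true]
    have heq : (fun t : ℝ => (Set.projIcc (0 : ℝ) 1 zero_le_one t : ℝ) * (criticalProbI 3 : ℝ))
        =ᶠ[nhds b] fun t => t * (criticalProbI 3 : ℝ) := by
      filter_upwards [Ioo_mem_nhds hb.1 hb.2] with t ht
      rw [Set.projIcc_of_mem zero_le_one (Set.Ioo_subset_Icc_self ht)]
    exact (hasDerivAt_mul_const (criticalProbI 3 : ℝ)).congr_of_eventuallyEq heq
  · simp only [hf, if_false]
    by_cases he : e ∈ halfSpaceEdgeSet 3
    · simp only [floorDilutedParam_of_not_mem_floorEdgeSet (criticalProbI 3) _ he hf]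
      exact hasDerivAt_const b _
    · simp only [floorDilutedParam_of_not_mem_halfSpaceEdgeSet (criticalProbI 3) _ he]
      exact hasDerivAt_const b _

/-! ### Unfoldings: the floor-diluted measure is `prodBernoulli` along the path -/

/-- `f_j(s) = (prodBernoulli (floorDilutedParam 3 p_c s))(armFrom r j)` (unfolding of
`armProbFloor` and `floorDilutedPercolation`). [folklore] -/
theorem armProbFloor_eq (r j : ℕ) (s : unitInterval) :
    armProbFloor r j s =
      (prodBernoulli (floorDilutedParam 3 (criticalProbI 3) s)).real (armFrom r j) := rfl

/-- `g_j(s) = Σ_{e ∈ floorEdgesIn (r+j+1)} (prodBernoulli (floorDilutedParam 3 p_c s))(e pivotal)`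
(unfolding of `pivotalFloorSum` and `floorDilutedPercolation`). [folklore] -/
theorem pivotalFloorSum_eq (r j : ℕ) (s : unitInterval) :
    pivotalFloorSum r j s = ∑ e ∈ floorEdgesIn (r + j + 1),
      (prodBernoulli (floorDilutedParam 3 (criticalProbI 3) s)).real
        {ω | IsPivotal (armFrom r j) e ω} := rfl

/-! ### Bookkeeping of the pivotal terms -/

/-- A pair outside the determining set `(box 3 (r+j)).sym2` of `armFrom r j` is never pivotal
(`Russo.mem_of_isPivotal`). [folklore] -/
theorem setOf_isPivotal_eq_empty (r j : ℕ) {e : Sym2 (Site 3)} (he : e ∉ (box 3 (r + j)).sym2) :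
    {ω | IsPivotal (armFrom r j) e ω} = ∅ :=
  Set.eq_empty_of_forall_notMem fun _ hω =>
    he (Russo.mem_of_isPivotal (determinedBy_armFrom r j) hω)

/-- The floor edges among the pairs of points of `Λ_{r+j}` belong to `floorEdgesIn (r+j+1)`
(`Λ_{r+j} ⊆ Λ_{r+j+1}`). [folklore] -/
theorem filter_sym2_subset_floorEdgesIn (r j : ℕ) :
    ((box 3 (r + j)).sym2.filter fun e => e ∈ floorEdgeSet 3) ⊆ floorEdgesIn (r + j + 1) := by
  intro e he
  rw [Finset.mem_filter, Finset.mem_sym2_iff] at he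
  exact mem_floorEdgesIn.2 ⟨fun x hx => box_mono 3 (Nat.le_succ _) (he.1 x hx), he.2⟩

/-- **The derivative of Russo's formula is `p_c · g_j`.** For any measure `μ`,
`Σ_{e ∈ (box 3 (r+j)).sym2} (p_c · 1[e floor]) · μ(e pivotal) = p_c · Σ_{e ∈ floorEdgesIn (r+j+1)} μ(e pivotal)`:
non-floor terms vanish, floor pairs of `Λ_{r+j}` lie in `floorEdgesIn (r+j+1)`, and the other
edges of `floorEdgesIn (r+j+1)` are never pivotal. [folklore] -/
theorem sum_ite_mul_real_pivotal_eq (r j : ℕ) (μ : Measure (BondConfig (Site 3))) :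
    ∑ e ∈ (box 3 (r + j)).sym2, (if e ∈ floorEdgeSet 3 then (criticalProbI 3 : ℝ) else 0) *
        μ.real {ω | IsPivotal (armFrom r j) e ω} =
      (criticalProbI 3 : ℝ) * ∑ e ∈ floorEdgesIn (r + j + 1),
        μ.real {ω | IsPivotal (armFrom r j) e ω} := by
  rw [Finset.mul_sum]
  simp_rw [ite_mul, zero_mul]
  rw [← Finset.sum_filter]
  refine Finset.sum_subset (filter_sym2_subset_floorEdgesIn r j) fun e he heK => ?_
  have heK' : e ∉ (box 3 (r + j)).sym2 := fun h =>
    heK (Finset.mem_filter.2 ⟨h, (mem_floorEdgesIn.1 he).2⟩)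
  rw [setOf_isPivotal_eq_empty r j heK', measureReal_empty, mul_zero]

/-! ### The three analytic conjuncts -/

/-- **Continuity of `t ↦ f_j(projIcc t)`**: `armFrom r j` is determined by the finite set
`(box 3 (r+j)).sym2` and the weights are continuous in `t`
(`continuous_prodBernoulli_real_of_determinedBy`). [folklore] -/
theorem continuous_armProbFloor (r j : ℕ) :
    Continuous (fun t : ℝ => armProbFloor r j (Set.projIcc (0 : ℝ) 1 zero_le_one t)) := by
  simp only [armProbFloor_eq]
  exact continuous_prodBernoulli_real_of_determinedBy
    (fun t : ℝ => floorDilutedParam 3 (criticalProbI 3) (Set.projIcc (0 : ℝ) 1 zero_le_one t))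
    (determinedBy_armFrom r j) fun e _ => continuous_coe_param e

/-- **Continuity of `t ↦ g_j(projIcc t)`**: each pivotality event is determined by the finite set
`(box 3 (r+j)).sym2 \ {e}` (`Russo.determinedBy_isPivotal`), so each summand is continuous
(`continuous_prodBernoulli_real_of_determinedBy`), and the sum is finite. [folklore] -/
theorem continuous_pivotalFloorSum (r j : ℕ) :
    Continuous (fun t : ℝ => pivotalFloorSum r j (Set.projIcc (0 : ℝ) 1 zero_le_one t)) := by
  simp only [pivotalFloorSum_eq]
  refine continuous_finsetSum _ fun e _ => ?_
  exact continuous_prodBernoulli_real_of_determinedBy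
    (fun t : ℝ => floorDilutedParam 3 (criticalProbI 3) (Set.projIcc (0 : ℝ) 1 zero_le_one t))
    (Russo.determinedBy_isPivotal (determinedBy_armFrom r j) e) fun e' _ => continuous_coe_param e'

/-- **Russo's formula in the floor density**: for `b ∈ (0,1)`,
`HasDerivAt (t ↦ f_j(projIcc t)) (p_c · g_j(projIcc b)) b` (`hasDerivAt_prodBernoulli_real` along
the path `t ↦ floorDilutedParam 3 p_c (projIcc t)` with `K = (box 3 (r+j)).sym2`, derivative
`p_c` on floor edges and `0` elsewhere, then `sum_ite_mul_real_pivotal_eq`). [folklore] -/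
theorem hasDerivAt_armProbFloor (r j : ℕ) {b : ℝ} (hb : b ∈ Set.Ioo (0 : ℝ) 1) :
    HasDerivAt (fun t : ℝ => armProbFloor r j (Set.projIcc (0 : ℝ) 1 zero_le_one t))
      ((criticalProbI 3 : ℝ) * pivotalFloorSum r j (Set.projIcc (0 : ℝ) 1 zero_le_one b)) b := by
  simp only [armProbFloor_eq, pivotalFloorSum_eq]
  refine (hasDerivAt_prodBernoulli_real
    (fun t : ℝ => floorDilutedParam 3 (criticalProbI 3) (Set.projIcc (0 : ℝ) 1 zero_le_one t))
    (isUpperSet_armFrom r j) (determinedBy_armFrom r j) b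
    (fun e => if e ∈ floorEdgeSet 3 then (criticalProbI 3 : ℝ) else 0)
    (fun e _ => hasDerivAt_coe_param e hb)).congr_deriv ?_
  exact sum_ite_mul_real_pivotal_eq r j _

end FloorDeriv

/-- **STUB 3a `stub_floorDeriv`** of line `microscopic-floor-doubling-gain`: readback
`f_j(1) = γ_r(j)` (`armProbFloor_one`), continuity of `t ↦ f_j(projIcc t)` and of
`t ↦ g_j(projIcc t)` (cylinder polynomials with continuous weights,
`FloorDeriv.continuous_armProbFloor`, `FloorDeriv.continuous_pivotalFloorSum`), and Russo's formula
in the floor density `HasDerivAt (t ↦ f_j(projIcc t)) (p_c · g_j(projIcc b)) b` for `b ∈ (0,1)`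
(`FloorDeriv.hasDerivAt_armProbFloor`). [folklore] -/
theorem stub_floorDeriv :
    ∀ r j : ℕ, armProbFloor r j 1 = gammaR r j ∧ Continuous (fun t : ℝ => armProbFloor r j (Set.projIcc (0 : ℝ) 1 zero_le_one t)) ∧ Continuous (fun t : ℝ => pivotalFloorSum r j (Set.projIcc (0 : ℝ) 1 zero_le_one t)) ∧ ∀ b : ℝ, b ∈ Set.Ioo (0 : ℝ) 1 → HasDerivAt (fun t : ℝ => armProbFloor r j (Set.projIcc (0 : ℝ) 1 zero_le_one t)) ((criticalProbI 3 : ℝ) * pivotalFloorSum r j (Set.projIcc (0 : ℝ) 1 zero_le_one b)) b :=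
  fun r j => ⟨armProbFloor_one r j, FloorDeriv.continuous_armProbFloor r j,
    FloorDeriv.continuous_pivotalFloorSum r j, fun _ hb => FloorDeriv.hasDerivAt_armProbFloor r j hb⟩

end Summit.CriticalPhenomena.PercolationContinuityZ3.Theorems

end
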